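import Summits.PneNP.PneNP.Theorems.PhaseTwinsMacroscopicTwinsAboveDefs
import Literature.ModelTheory.FiniteModelTheory.XorLocalConsistency

/-!
# Route PhaseTwins, crux `MacroscopicTwinsAbove` (stmt-PneNP-2720), line `literal-gadgets-cfi-apparatus`:
# stub `stub_duplicator`

Duplicator wins the bijective `k`-pebble game on the literal-gadget graphs `lgGraph E loc W 0` and
`lgGraph E loc W b` — for EVERY right-hand side `b`, gadget/wiring `W` and occurrence labelling `loc` — whenever
the 3-XOR system `E` (three distinct variables per equation) is an `(s, q/p)`-boundary expander, `2pK₀ ≤ qs` and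
`3k ≤ K₀`. This is ONE INSTANCE of the abstract transfer theorem `ckEquiv_of_consistencyFamily`
(Atserias–Dawar 2019, Lemma 3.2; Cai–Fürer–Immerman 1992, §6) with

* the local flip action `lgFlip E` (the gauge action of an assignment `f : Fin nv → ZMod 2`) for the data map
  `lgData E` (`≤ 3` variables per vertex; `isLocalFlipAction_lgFlip`, `card_lgData_le` of the definitions file);
* the consistency family `XorSystem.Good (lgScope E) b s` with bound `K₀` (`XorSystem.good_empty`,
  `XorSystem.good_extend`);
* the compatibility clause `lgGraph_adj_flip_iff`: the flip by a consistent `f` carries adjacency of `lgGraph … 0`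
  to adjacency of `lgGraph … b` between vertices whose data lies in the domain — pair edges and end–copy edges
  shift the two bits they compare by the same value, and at an inner vertex of equation `e` (data = the scope of
  `e`, so `∑ i, f (E e i) = b e` by `XorSystem.Good.sum_scope_eq`) the represented bits transform by
  `bit (b e) (S' + f ∘ E e ∘ castSucc) i = bit 0 S' i + f (E e i)` (`bit_flip`).
-/

noncomputable section

open scoped Classical BigOperators

namespace Summit.PneNP.PneNP.Cruxes.MacroscopicTwinsAbove.LiteralGadgetsCfiApparatus

open Finset
open Literature.ModelTheory.FiniteModelTheory (CkEquiv IsConsistencyFamily IsLocalFlipAction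
  ckEquiv_of_consistencyFamily)
open Literature.ModelTheory.FiniteModelTheory.CFIMatching (bit zmod2_add_self fin3_eq_two)
open Literature.ModelTheory.FiniteModelTheory.XorSystem (Good good_empty good_extend)

-- `Summit.PneNP.PneNP.…` (summit = sub-problem name) trips the duplicate-namespace linter on every declaration.
set_option linter.dupNamespace false

variable {nv m v P κ₁ D K : ℕ}

/-! ### The represented bits and the scope sums under a flip -/

/-- **The represented bits transform additively under the flip of a SATISFIED equation**: if
`F 0 + F 1 + F 2 = c` then `bit c (S' + F ∘ castSucc) i = bit 0 S' i + F i` (the two free bits move by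
`F 0`, `F 1`; the third, `c + S' 0 + S' 1`, moves by `F 0 + F 1 = c + F 2` in characteristic two). -/
theorem bit_flip (F : Fin 3 → ZMod 2) {c : ZMod 2} (h : F 0 + F 1 + F 2 = c) (S' : Fin 2 → ZMod 2)
    (i : Fin 3) : bit c (S' + fun k => F (Fin.castSucc k)) i = bit 0 S' i + F i := by
  subst h
  unfold bit
  by_cases h0 : i = 0
  · subst h0; simp
  · by_cases h1 : i = 1
    · subst h1; simp
    · obtain rfl : i = 2 := fin3_eq_two h0 h1
      simp only [Fin.reduceEq, ↓reduceIte, Pi.add_apply, zero_add]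
      have e0 : (Fin.castSucc (0 : Fin 2) : Fin 3) = 0 := rfl
      have e1 : (Fin.castSucc (1 : Fin 2) : Fin 3) = 1 := rfl
      rw [e0, e1]
      linear_combination zmod2_add_self (F 0) + zmod2_add_self (F 1)

/-- The sum of an assignment over the scope of equation `e` (three DISTINCT variables) is
`f (E e 0) + f (E e 1) + f (E e 2)`. -/
theorem sum_lgScope_eq (E : Fin m → Fin 3 → Fin nv) (hE : ∀ e, Function.Injective (E e))
    (f : Fin nv → ZMod 2) (e : Fin m) : ∑ x ∈ lgScope E e, f x = f (E e 0) + f (E e 1) + f (E e 2) := by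
  rw [lgScope, Finset.sum_image fun a _ b _ h => hE e h, Fin.sum_univ_three]

/-! ### The flip by a consistent assignment is a partial isomorphism -/

/-- **The flip by a consistent assignment transports `lgRel … 0` to `lgRel … b`** from a vertex whose data lies
in the domain: pair edges compare the bits of the two literal gadgets of one variable `x` (both shifted by
`f x`), the end `(e, j, i, a)` and its port copy in `g_{E e i, a}` are shifted by the same `f (E e i)`, and at an
inner vertex of `e` the scope of `e` lies in the domain, so `∑ i, f (E e i) = b e` (`Good.sum_scope_eq`) and
`bit_flip` applies. -/
theorem lgRel_flip_iff (E : Fin m → Fin 3 → Fin nv) (hE : ∀ e, Function.Injective (E e))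
    (loc : Fin m × Fin 3 → Fin D) (W : LWiring v P κ₁ D K) (b : Fin m → ZMod 2) {s : ℕ} (hs : 1 ≤ s)
    {dom : Finset (Fin nv)} {f : Fin nv → ZMod 2} (hf : Good (lgScope E) b s dom f) {x : LGVert nv m v K}
    (hx : lgData E x ⊆ dom) (y : LGVert nv m v K) :
    lgRel E loc W b (lgFlipFun E f x) (lgFlipFun E f y) ↔ lgRel E loc W 0 x y := by
  rcases x with ⟨x, a, z⟩ | ⟨e, j, i, a⟩ | ⟨e, j, S⟩ <;>
    rcases y with ⟨x', a', z'⟩ | ⟨e', j', i', a'⟩ | ⟨e', j', S'⟩ <;>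
    simp only [lgFlipFun, lgRel, Pi.zero_apply]
  · -- copy / copy
    constructor
    · rintro (⟨rfl, ha, hadj⟩ | ⟨rfl, ha, hj⟩)
      · exact Or.inl ⟨rfl, add_right_cancel ha, hadj⟩
      · refine Or.inr ⟨rfl, ?_, hj⟩
        rw [add_right_comm] at ha
        exact add_right_cancel ha
    · rintro (⟨rfl, rfl, hadj⟩ | ⟨rfl, rfl, hj⟩)
      · exact Or.inl ⟨rfl, rfl, hadj⟩
      · exact Or.inr ⟨rfl, add_right_comm _ _ _, hj⟩
  · -- end / copy
    constructor
    · rintro ⟨rfl, ha, hz⟩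
      exact ⟨rfl, add_right_cancel ha, hz⟩
    · rintro ⟨rfl, rfl, hz⟩
      exact ⟨rfl, rfl, hz⟩
  · -- inner / end
    have hsc : lgScope E e ⊆ dom := hx
    have hsum : f (E e 0) + f (E e 1) + f (E e 2) = b e := by
      rw [← sum_lgScope_eq E hE f e]
      exact hf.sum_scope_eq hs hsc
    have key := bit_flip (fun i => f (E e i)) hsum S
    constructor
    · rintro ⟨rfl, hj, h⟩
      refine ⟨rfl, hj, ?_⟩
      rw [key] at h
      exact add_right_cancel h
    · rintro ⟨rfl, hj, h⟩
      refine ⟨rfl, hj, ?_⟩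
      rw [key, h]

/-- **Compatibility** (the hypothesis `hcompat` of `ckEquiv_of_consistencyFamily`): the flip by a consistent
assignment preserves and reflects adjacency `lgGraph … 0 → lgGraph … b` between any two vertices whose data lies
in the domain (symmetrise `lgRel_flip_iff`; the flip is injective). -/
theorem lgGraph_adj_flip_iff (E : Fin m → Fin 3 → Fin nv) (hE : ∀ e, Function.Injective (E e))
    (loc : Fin m × Fin 3 → Fin D) (W : LWiring v P κ₁ D K) (b : Fin m → ZMod 2) {s : ℕ} (hs : 1 ≤ s)
    {dom : Finset (Fin nv)} {f : Fin nv → ZMod 2} (hf : Good (lgScope E) b s dom f) {x y : LGVert nv m v K}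
    (hx : lgData E x ⊆ dom) (hy : lgData E y ⊆ dom) :
    (lgGraph E loc W b).Adj (lgFlip E f x) (lgFlip E f y) ↔ (lgGraph E loc W 0).Adj x y := by
  have hinv : Function.Involutive (lgFlipFun (v := v) (K := K) E f) := lgFlipFun_lgFlipFun E f
  rw [lgFlip_apply, lgFlip_apply, lgGraph_adj, lgGraph_adj, hinv.injective.ne_iff,
    lgRel_flip_iff E hE loc W b hs hf hx y, lgRel_flip_iff E hE loc W b hs hf hy x]

/-! ### The stub -/

/-- **S3 — Duplicator (Lemma A of the card: CFI gauge + local consistency; Atserias–Dawar 2019 Lemma 3.2 in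
the abstract form `ckEquiv_of_consistencyFamily`).** On an `(s, q/p)`-boundary expander with `2pK₀ ≤ qs` and
`3k ≤ K₀`, the literal-gadget graphs of ANY right-hand side `b` and of `0` are `≡_{C^k}` — for every gadget,
wiring and occurrence labelling: take `R := ZMod 2`, the consistency family `XorSystem.Good (lgScope E) b s` with
bound `K₀` (`good_empty`, `good_extend`), the local flip action `lgFlip E` for the data `lgData E` (`c₀ = 3`), and
the compatibility clause `lgGraph_adj_flip_iff`. -/
theorem stub_duplicator (E : Fin m → Fin 3 → Fin nv) (hE : ∀ e, Function.Injective (E e))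
    (loc : Fin m × Fin 3 → Fin D) (W : LWiring v P κ₁ D K) (b : Fin m → ZMod 2) {s p q K₀ k : ℕ}
    (hs : 1 ≤ s) (hq : 0 < q)
    (hexp : ∀ T : Finset (Fin m), T.card ≤ s →
      q * T.card ≤ p * (Literature.ModelTheory.FiniteModelTheory.XorSystem.boundary (lgScope E) T).card)
    (hK₀ : 2 * p * K₀ ≤ q * s) (hk : 3 * k ≤ K₀) :
    CkEquiv k (lgGraph E loc W 0) (lgGraph E loc W b) := by
  -- the consistency family of the expanding system (`XorHamGame.isConsistencyFamily_good`, re-packaged)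
  have hG : IsConsistencyFamily (Good (lgScope E) b s) K₀ :=
    ⟨good_empty hq hexp, fun _ _ _ h hsub => h.mono hsub, fun _ _ _ h hfg => h.congr hfg,
      fun _ _ h hcard x => good_extend hq hexp hK₀ h hcard x⟩
  exact ckEquiv_of_consistencyFamily (R := ZMod 2) hG (isLocalFlipAction_lgFlip E) (card_lgData_le E)
    (fun _ _ _ _ hf hx hy => lgGraph_adj_flip_iff E hE loc W b hs hf hx hy) hk

end Summit.PneNP.PneNP.Cruxes.MacroscopicTwinsAbove.LiteralGadgetsCfiApparatus
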